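import Literature.Analysis.FluidPDE.ClassicalBoundedUniformDerivativeBounds
import Literature.Analysis.FluidPDE.ClassicalSolutionRescale
import Literature.Analysis.FluidPDE.SobolevWholeSpace
import Literature.Analysis.FluidPDE.NSWeakStrongUniquenessProofs
import Literature.Analysis.FluidPDE.TaoEnstrophyLocalisationProofs
import Literature.Analysis.FluidPDE.SolenoidalTruncation
import Literature.Analysis.FluidPDE.LerayHopf
import Literature.Analysis.FluidPDE.RapidDecayLemmas
import HarnessLib

/-!
# Tools for `LerayQuarterDissipation.RecordTimeTypeI` (item stmt-NavierStokesRegularity-22145):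
# the RECORD-TIME CAPACITY step — a near-record amplitude `a` costs enstrophy `≳ ν a`

`--supports stmt-NavierStokesRegularity-22145`. The item says: a classical Leray–Hopf solution on
`[0,T)` with the quarter-rate enstrophy bound `∫|curl u(t)|² ≤ K/√(T−t)` is velocity-Type-I. This
file proves the load-bearing step (`record_le`): if at a time `s ∈ (0,T)` the solution is bounded by
`2a` on the whole past `[0,s] × ℝ³`, exceeds `3a/2` somewhere at time `s`, and the smoothing window
fits (`2ν/a² ≤ s`), then `a ≤ D₀/√(T−s)` with `D₀` depending only on `ν`, `K` and universal
constants. Mechanism (the item card): rescale the window `[s − 2ν/a², s]` to the unit-viscosity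
slab `[0,2]` with sup bound `2` (`IsClassicalNSSolutionOn.stRescale`); KNSS (4.10) for bounded
classical solutions with constants chosen first (`exists_uniform_iteratedFDeriv_bound_of_bounded_classical`)
bounds the rescaled gradient by a universal `C₀` on `(1,2)`, i.e. `u(t,·)` is `C₀a²/ν`-Lipschitz for
`t ∈ (s − ν/a², s)`; by time continuity some such `t` still has `|u(t,x₀)| > 5a/4`, hence
`|u(t,·)| ≥ a` on the ball of radius `ν/(4C₀a)`; Sobolev `Ḣ¹ ⊂ L⁶`
(`eLpNorm_six_le_eLpNorm_fderiv_two`), `∫|∇u|²_F ≤ ∫|curl u|²` and the quarter law give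
`a⁶ (ν/(4C₀a))³ |B₁| ≤ K_S⁶ (K/√(T−t))³`, i.e. `a ≤ 4C₀K_S²K⁺/(ν|B₁|^{1/3}√(T−s))`.

* `lintegral_pow_six_ge_ball` — `a⁶ρ³|B₁| ≤ ∫‖v‖⁶` when `‖v‖ ≥ a` on a ball of radius `ρ`;
* `lintegral_pow_six_le_curl` — `∫‖v‖⁶ ≤ K_S⁶ (∫|curl v|²)³` for a `C²` divergence-free `L²` field;
* `record_le` — the record-time capacity inequality.

HONEST FRAMING: estimates for a GIVEN classical solution under a HYPOTHESISED enstrophy law; nothing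
here asserts that the quarter law holds, and nothing about NS regularity is claimed. References:
Koch–Nadirashvili–Seregin–Šverák, Acta Math. 203 (2009) §4 (4.10); Leray 1934 §20 (scaling);
Evans, PDE §5.6.1 (Sobolev). [folklore]
-/

noncomputable section

open Set Filter Topology MeasureTheory Metric
open scoped ENNReal NNReal
open Literature.Analysis.FluidPDE

namespace Summit.NavierStokesRegularity.NavierStokesRegularity.Theorems

-- the problem directory repeats the summit name (`NavierStokesRegularity/NavierStokesRegularity`)
set_option linter.dupNamespace false

namespace RecordTimeTypeI

/-- **Amplitude on a ball costs `L⁶` mass**: if `‖v‖ ≥ a ≥ 0` on `ball x₀ ρ` then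
`a⁶ ρ³ |B₁| ≤ ∫ ‖v‖⁶` (lower Lebesgue integrals; `|B₁|` the volume of the unit ball). [folklore] -/
theorem lintegral_pow_six_ge_ball {v : (EuclideanSpace ℝ (Fin 3)) → (EuclideanSpace ℝ (Fin 3))} (hv : Continuous v) {a ρ : ℝ} (ha : 0 ≤ a)
    (hρ : 0 < ρ) (x₀ : (EuclideanSpace ℝ (Fin 3))) (h : ∀ x ∈ ball x₀ ρ, a ≤ ‖v x‖) :
    ENNReal.ofReal (a ^ 6 * ρ ^ 3) * volume (ball (0 : (EuclideanSpace ℝ (Fin 3))) 1) ≤ ∫⁻ x, ‖v x‖ₑ ^ 6 := by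
  have hmeas : Measurable fun x => ‖v x‖ₑ ^ 6 := hv.measurable.enorm.pow_const _
  have hvol : volume (ball x₀ ρ) = ENNReal.ofReal (ρ ^ 3) * volume (ball (0 : (EuclideanSpace ℝ (Fin 3))) 1) := by
    rw [Measure.addHaar_ball volume x₀ hρ.le, finrank_euclideanSpace_fin]
  calc ENNReal.ofReal (a ^ 6 * ρ ^ 3) * volume (ball (0 : (EuclideanSpace ℝ (Fin 3))) 1)
      = ENNReal.ofReal a ^ 6 * volume (ball x₀ ρ) := by
        rw [hvol, ENNReal.ofReal_mul (by positivity), ENNReal.ofReal_pow ha, mul_assoc]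
    _ = ∫⁻ _ in ball x₀ ρ, ENNReal.ofReal a ^ 6 := by rw [setLIntegral_const]
    _ ≤ ∫⁻ x in ball x₀ ρ, ‖v x‖ₑ ^ 6 := by
        refine setLIntegral_mono hmeas fun x hx => ?_
        have h1 : ENNReal.ofReal a ≤ ‖v x‖ₑ := by
          rw [← ofReal_norm]
          exact ENNReal.ofReal_le_ofReal (h x hx)
        gcongr
    _ ≤ ∫⁻ x, ‖v x‖ₑ ^ 6 := setLIntegral_le_lintegral _ _

/-- **Sobolev against the enstrophy**: for a `C²` divergence-free `L²` field `v` on `ℝ³`,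
`∫ ‖v‖⁶ ≤ K_S⁶ (∫ |curl v|²)³`, `K_S` Mathlib's Gagliardo–Nirenberg–Sobolev constant
(`Ḣ¹ ⊂ L⁶`, `‖Dv‖_{L²} ≤ (∫|Dv|²_F)^{1/2}`, `∫|Dv|²_F ≤ ∫|curl v|²`). [folklore] -/
theorem lintegral_pow_six_le_curl {v : (EuclideanSpace ℝ (Fin 3)) → (EuclideanSpace ℝ (Fin 3))} (hv : ContDiff ℝ 2 v)
    (hdiv : VectorCalculus.IsDivFree v) (hv2 : MemLp v 2 volume) :
    ∫⁻ x, ‖v x‖ₑ ^ 6 ≤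
      (SNormLESNormFDerivOfEqConst (EuclideanSpace ℝ (Fin 3)) (volume : Measure (EuclideanSpace ℝ (Fin 3))) 2 : ℝ≥0∞) ^ 6 *
        (∫⁻ x, ‖curl v x‖ₑ ^ 2) ^ 3 := by
  set KS : ℝ≥0∞ := (SNormLESNormFDerivOfEqConst (EuclideanSpace ℝ (Fin 3)) (volume : Measure (EuclideanSpace ℝ (Fin 3))) 2 : ℝ≥0∞) with hKS
  set Z : ℝ≥0∞ := ∫⁻ x, ‖curl v x‖ₑ ^ 2 with hZ
  have hL2 : ∫⁻ x, ‖v x‖ₑ ^ 2 < ⊤ := by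
    have h := lintegral_rpow_enorm_lt_top_of_eLpNorm_lt_top two_ne_zero ENNReal.ofNat_ne_top
      hv2.eLpNorm_lt_top
    simpa [ENNReal.toReal_ofNat] using h
  have h1 : eLpNorm v 6 volume ≤ KS * eLpNorm (fderiv ℝ v) 2 volume :=
    eLpNorm_six_le_eLpNorm_fderiv_two volume finrank_euclideanSpace_fin
      (hv.of_le (by norm_num)) hv2.eLpNorm_lt_top
  have h2 : eLpNorm (fderiv ℝ v) 2 volume ≤
      (∫⁻ x, ENNReal.ofReal (frobeniusNormSq (fderiv ℝ v x))) ^ (1 / 2 : ℝ) :=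
    eLpNorm_two_le_lintegral_frobenius_rpow volume _
  have h3 : ∫⁻ x, ENNReal.ofReal (frobeniusNormSq (fderiv ℝ v x)) ≤ Z :=
    lintegral_frobeniusNormSq_fderiv_le_lintegral_sq_norm_curl hv hdiv hL2
  have hS6 : eLpNorm v 6 volume ≤ KS * Z ^ (1 / 2 : ℝ) :=
    h1.trans (mul_le_mul_of_nonneg_left (h2.trans (ENNReal.rpow_le_rpow h3 (by norm_num)))
      bot_le)
  -- `∫‖v‖⁶ = (eLpNorm v 6)^6`
  have h6 : ∫⁻ x, ‖v x‖ₑ ^ 6 = eLpNorm v 6 volume ^ (6 : ℝ) := by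
    rw [eLpNorm_eq_lintegral_rpow_enorm_toReal (by norm_num) (by norm_num), ENNReal.toReal_ofNat,
      ← ENNReal.rpow_mul, show (1 / (6 : ℝ) * 6) = 1 by norm_num, ENNReal.rpow_one]
    refine lintegral_congr fun x => ?_
    rw [show (6 : ℝ) = ((6 : ℕ) : ℝ) by norm_num, ENNReal.rpow_natCast]
  rw [h6]
  calc eLpNorm v 6 volume ^ (6 : ℝ) ≤ (KS * Z ^ (1 / 2 : ℝ)) ^ (6 : ℝ) :=
        ENNReal.rpow_le_rpow hS6 (by norm_num)
    _ = KS ^ 6 * Z ^ 3 := by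
        rw [ENNReal.mul_rpow_of_nonneg _ _ (by norm_num), ← ENNReal.rpow_mul,
          show (1 / 2 : ℝ) * 6 = ((3 : ℕ) : ℝ) by norm_num, ENNReal.rpow_natCast,
          show (6 : ℝ) = ((6 : ℕ) : ℝ) by norm_num, ENNReal.rpow_natCast]

/-- Cube-root bookkeeping: `(x)³ ≤ (y)³` with `x, y ≥ 0` gives `x ≤ y`. [folklore] -/
theorem le_of_cube_le {x y : ℝ} (hx : 0 ≤ x) (hy : 0 ≤ y) (h : x ^ 3 ≤ y ^ 3) : x ≤ y :=
  (pow_le_pow_iff_left₀ hx hy (by norm_num)).1 h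

/-- **The record-time capacity inequality.** Let `(u,p)` be a classical solution of the unforced
system on `ℝ³ × [0,T)` (`ν > 0`), Leray–Hopf from `u 0`, with the quarter-rate enstrophy law
`∫|curl u(t)|² ≤ K/√(T−t)` on `[0,T)`; let `C₀ > 0` be a KNSS (4.10) gradient constant for
unit-viscosity classical finite-energy solutions bounded by `2` on `[0,2]` (gradient `≤ C₀` on
`(1,2)`). If at `s ∈ (0,T)` the solution is bounded by `2a` on `[0,s] × ℝ³` (`a > 0`), exceeds
`3a/2` at some point at time `s`, and `2ν/a² ≤ s`, then
`a ≤ 4 C₀ K_S² max(K,0) / (ν |B₁|^{1/3}) · (T−s)^{−1/2}`.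
[cite: KochNadirashviliSereginSverak2009, §4 (4.10); Leray1934, §20] -/
theorem record_le {ν T K : ℝ} (hν : 0 < ν)
    {u : ℝ → (EuclideanSpace ℝ (Fin 3)) → (EuclideanSpace ℝ (Fin 3))} {p : ℝ → (EuclideanSpace ℝ (Fin 3)) → ℝ}
    (hsol : IsClassicalNSSolutionOn (Ico 0 T) ν 0 u p) (hLH : IsLerayHopfOn T ν 0 (u 0) u)
    (hquarter : ∀ t ∈ Ico 0 T,
      ∫⁻ x, ‖curl (u t) x‖ₑ ^ 2 ≤ ENNReal.ofReal (K / Real.sqrt (T - t)))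
    {C₀ : ℝ} (hC₀ : 0 < C₀)
    (hgrad : ∀ ⦃w : ℝ → (EuclideanSpace ℝ (Fin 3)) → (EuclideanSpace ℝ (Fin 3))⦄ ⦃q : ℝ → (EuclideanSpace ℝ (Fin 3)) → ℝ⦄, IsClassicalNSSolutionOn (Icc 0 2) 1 0 w q →
      (∃ C : ℝ≥0∞, C < ⊤ ∧ ∀ r ∈ Icc (0 : ℝ) 2, ∫⁻ y, ‖w r y‖ₑ ^ 2 ≤ C) →
      (∀ r ∈ Icc (0 : ℝ) 2, ∀ y, ‖w r y‖ ≤ 2) →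
      ∀ r ∈ Ioo (1 : ℝ) 2, ∀ y, ‖fderiv ℝ (w r) y‖ ≤ C₀)
    {s a : ℝ} (hs : s ∈ Ioo 0 T) (ha : 0 < a) (hwin : 2 * ν / a ^ 2 ≤ s)
    (hbd : ∀ σ ∈ Icc 0 s, ∀ y, ‖u σ y‖ ≤ 2 * a) {x₀ : (EuclideanSpace ℝ (Fin 3))} (hx₀ : 3 * a / 2 < ‖u s x₀‖) :
    a ≤ 4 * C₀ * (SNormLESNormFDerivOfEqConst (EuclideanSpace ℝ (Fin 3)) (volume : Measure (EuclideanSpace ℝ (Fin 3))) 2 : ℝ) ^ 2 * max K 0 /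
      (ν * (volume (ball (0 : (EuclideanSpace ℝ (Fin 3))) 1)).toReal ^ ((1 : ℝ) / 3)) / Real.sqrt (T - s) := by
  -- constants
  set KSr : ℝ := (SNormLESNormFDerivOfEqConst (EuclideanSpace ℝ (Fin 3)) (volume : Measure (EuclideanSpace ℝ (Fin 3))) 2 : ℝ) with hKSr
  have hKSr0 : 0 ≤ KSr := NNReal.coe_nonneg _
  have hV₁top : volume (ball (0 : (EuclideanSpace ℝ (Fin 3))) 1) < ⊤ := measure_ball_lt_top
  have hV₁pos : 0 < volume (ball (0 : (EuclideanSpace ℝ (Fin 3))) 1) := measure_ball_pos volume 0 one_pos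
  set v₁ : ℝ := (volume (ball (0 : (EuclideanSpace ℝ (Fin 3))) 1)).toReal with hv₁
  have hv₁pos : 0 < v₁ := ENNReal.toReal_pos hV₁pos.ne' hV₁top.ne
  set c₁ : ℝ := v₁ ^ ((1 : ℝ) / 3) with hc₁
  have hc₁pos : 0 < c₁ := Real.rpow_pos_of_pos hv₁pos _
  have hc₁cube : c₁ ^ 3 = v₁ := by
    rw [hc₁, ← Real.rpow_natCast, ← Real.rpow_mul hv₁pos.le]; norm_num
  -- the rescaling `w(r, y) = a⁻¹ u(t₀ + β r, γ y)`, `β = ν/a²`, `γ = ν/a`, `t₀ = s − 2β`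
  set β : ℝ := ν / a ^ 2 with hβ
  set γ : ℝ := ν / a with hγ
  set t₀ : ℝ := s - 2 * β with ht₀
  have hβpos : 0 < β := by positivity
  have hγpos : 0 < γ := by positivity
  have ht₀0 : 0 ≤ t₀ := by rw [ht₀, hβ]; linarith [show 2 * (ν / a ^ 2) = 2 * ν / a ^ 2 by ring]
  have hβαγ : β = a⁻¹ * γ := by rw [hβ, hγ]; field_simp
  have hvisc : a⁻¹ * ν / γ = 1 := by rw [hγ]; field_simp
  have hresc := hsol.stRescale (inv_pos.2 ha) hγpos hβαγ t₀ (0 : (EuclideanSpace ℝ (Fin 3)))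
  rw [hvisc, smul_stPull_zero] at hresc
  -- the window `[0,2]` maps into `[t₀, s] ⊂ [0, T)`
  have hmap : ∀ r ∈ Icc (0 : ℝ) 2, t₀ + β * r ∈ Icc t₀ s := fun r hr =>
    ⟨by nlinarith [hr.1], by rw [ht₀]; nlinarith [hr.2]⟩
  have hsub : Icc (0 : ℝ) 2 ⊆ (fun r => t₀ + β * r) ⁻¹' Ico 0 T := fun r hr =>
    ⟨ht₀0.trans (hmap r hr).1, (hmap r hr).2.trans_lt hs.2⟩
  have hw : IsClassicalNSSolutionOn (Icc 0 2) 1 0 (a⁻¹ • stPull β γ t₀ (0 : (EuclideanSpace ℝ (Fin 3))) u)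
      ((a⁻¹) ^ 2 • stPull β γ t₀ (0 : (EuclideanSpace ℝ (Fin 3))) p) :=
    hresc.mono hsub (uniqueDiffOn_Icc (by norm_num))
  -- sup bound `2` and finite energy of the rescaled solution
  have hwbd : ∀ r ∈ Icc (0 : ℝ) 2, ∀ y, ‖(a⁻¹ • stPull β γ t₀ (0 : (EuclideanSpace ℝ (Fin 3))) u) r y‖ ≤ 2 := by
    intro r hr y
    rw [smul_stPull_slice]
    simp only [norm_smul, norm_inv, Real.norm_eq_abs, abs_of_pos ha]
    have hmem : t₀ + β * r ∈ Icc 0 s := ⟨ht₀0.trans (hmap r hr).1, (hmap r hr).2⟩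
    have := hbd _ hmem (0 + γ • y)
    rw [inv_mul_le_iff₀ ha]
    linarith
  have hwE : ∃ C : ℝ≥0∞, C < ⊤ ∧ ∀ r ∈ Icc (0 : ℝ) 2,
      ∫⁻ y, ‖(a⁻¹ • stPull β γ t₀ (0 : (EuclideanSpace ℝ (Fin 3))) u) r y‖ₑ ^ 2 ≤ C := by
    refine ⟨‖a⁻¹‖ₑ ^ 2 * (ENNReal.ofReal |(γ ^ Module.finrank ℝ (EuclideanSpace ℝ (Fin 3)))⁻¹| *
      ENNReal.ofReal (2 * VectorCalculus.kineticEnergy (u 0))), ?_, fun r hr => ?_⟩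
    · exact ENNReal.mul_lt_top (ENNReal.pow_lt_top enorm_lt_top)
        (ENNReal.mul_lt_top ENNReal.ofReal_lt_top ENNReal.ofReal_lt_top)
    · have hmem : t₀ + β * r ∈ Icc 0 T :=
        ⟨ht₀0.trans (hmap r hr).1, ((hmap r hr).2.trans hs.2.le)⟩
      have hE := hLH.lintegral_enorm_sq_le hν.le hmem
      rw [smul_stPull_slice]
      simp only [zero_add, enorm_smul, mul_pow]
      rw [lintegral_const_mul' _ _ (ENNReal.pow_ne_top enorm_ne_top),
        lintegral_comp_smul (fun z => ‖u (t₀ + β * r) z‖ₑ ^ 2) hγpos.ne']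
      gcongr
  have hgradw := hgrad hw hwE hwbd
  -- Lipschitz bound of `u(t, ·)` for `t ∈ (s − β, s)`: constant `C₀ a²/ν`
  have hLip : ∀ t ∈ Ioo (s - β) s, ∀ x x' : (EuclideanSpace ℝ (Fin 3)), ‖u t x - u t x'‖ ≤ C₀ * a ^ 2 / ν * ‖x - x'‖ := by
    intro t ht x x'
    set r : ℝ := (t - t₀) / β with hr
    have hr12 : r ∈ Ioo (1 : ℝ) 2 := by
      rw [hr, mem_Ioo, lt_div_iff₀ hβpos, div_lt_iff₀ hβpos, ht₀]
      constructor <;> linarith [ht.1, ht.2]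
    have htr : t₀ + β * r = t := by rw [hr]; field_simp; ring
    -- `u t z = a • w r (γ⁻¹ • z)`
    have hrepr : ∀ z : (EuclideanSpace ℝ (Fin 3)), u t z = a • (a⁻¹ • stPull β γ t₀ (0 : (EuclideanSpace ℝ (Fin 3))) u) r (γ⁻¹ • z) := by
      intro z
      rw [smul_stPull_slice]
      simp only [zero_add, smul_smul, mul_inv_cancel₀ hγpos.ne', one_smul, htr,
        mul_inv_cancel₀ ha.ne']
    have hdiff : ∀ z ∈ (univ : Set (EuclideanSpace ℝ (Fin 3))),
        DifferentiableAt ℝ ((a⁻¹ • stPull β γ t₀ (0 : (EuclideanSpace ℝ (Fin 3))) u) r) z := fun z _ =>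
      ((hw.contDiff_velocity ⟨by linarith [hr12.1], hr12.2.le⟩).differentiable (by simp)).differentiableAt
    have hmvt := (convex_univ (𝕜 := ℝ) (E := (EuclideanSpace ℝ (Fin 3)))).norm_image_sub_le_of_norm_fderiv_le hdiff
      (fun z _ => hgradw r hr12 z) (mem_univ (γ⁻¹ • x')) (mem_univ (γ⁻¹ • x))
    rw [hrepr x, hrepr x', ← smul_sub, norm_smul, Real.norm_eq_abs, abs_of_pos ha]
    calc a * ‖(a⁻¹ • stPull β γ t₀ (0 : (EuclideanSpace ℝ (Fin 3))) u) r (γ⁻¹ • x) -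
          (a⁻¹ • stPull β γ t₀ (0 : (EuclideanSpace ℝ (Fin 3))) u) r (γ⁻¹ • x')‖
        ≤ a * (C₀ * ‖γ⁻¹ • x - γ⁻¹ • x'‖) := mul_le_mul_of_nonneg_left hmvt ha.le
      _ = C₀ * a ^ 2 / ν * ‖x - x'‖ := by
          rw [← smul_sub, norm_smul, norm_inv, Real.norm_eq_abs, abs_of_pos hγpos, hγ]
          field_simp
  -- a time `t ∈ (s − β, s)`, `t ≥ 0`, at which `|u(t, x₀)| > 5a/4`
  obtain ⟨t, ht, ht0, hbig⟩ : ∃ t ∈ Ioo (s - β) s, 0 ≤ t ∧ 5 * a / 4 < ‖u t x₀‖ := by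
    have hsI : s ∈ Ico 0 T := ⟨hs.1.le, hs.2⟩
    have hcont := IsSmoothSpaceTimeOn.continuousWithinAt_time hsol.smooth_velocity hsI x₀
    have hx₀' : 5 * a / 4 < ‖u s x₀‖ := by linarith
    have h1 : ∀ᶠ σ in 𝓝[Ico 0 T] s, 5 * a / 4 < ‖u σ x₀‖ :=
      hcont.eventually ((isOpen_lt continuous_const continuous_norm).mem_nhds hx₀')
    have h2 : ∀ᶠ σ in 𝓝[Ico 0 T] s, σ ∈ Ioo (s - β) (s + β) :=
      mem_nhdsWithin_of_mem_nhds (Ioo_mem_nhds (by linarith) (by linarith))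
    have h3 : ∀ᶠ σ in 𝓝[Ico 0 s] s, (5 * a / 4 < ‖u σ x₀‖ ∧ σ ∈ Ioo (s - β) (s + β)) ∧
        σ ∈ Ico 0 s :=
      ((h1.and h2).filter_mono (nhdsWithin_mono s (Ico_subset_Ico_right hs.2.le))).and
        eventually_mem_nhdsWithin
    have hne : (𝓝[Ico 0 s] s).NeBot := by
      refine mem_closure_iff_nhdsWithin_neBot.1 ?_
      rw [closure_Ico hs.1.ne]
      exact right_mem_Icc.2 hs.1.le
    obtain ⟨σ, ⟨hσ1, hσ2⟩, hσ3⟩ := h3.exists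
    exact ⟨σ, ⟨hσ2.1, hσ3.2⟩, hσ3.1, hσ1⟩
  have htI : t ∈ Ico 0 T := ⟨ht0, ht.2.trans hs.2⟩
  -- `|u(t, ·)| ≥ a` on the ball of radius `ρ = ν/(4 C₀ a)` about `x₀`
  set ρ : ℝ := ν / (4 * C₀ * a) with hρ
  have hρpos : 0 < ρ := by positivity
  have hball : ∀ x ∈ ball x₀ ρ, a ≤ ‖u t x‖ := by
    intro x hx
    have hd : ‖x₀ - x‖ < ρ := by rw [← dist_eq_norm, dist_comm]; exact hx
    have hL := hLip t ht x₀ x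
    have hL' : ‖u t x₀ - u t x‖ ≤ C₀ * a ^ 2 / ν * ρ :=
      hL.trans (mul_le_mul_of_nonneg_left hd.le (by positivity))
    have hρa : C₀ * a ^ 2 / ν * ρ = a / 4 := by rw [hρ]; field_simp
    have htri : ‖u t x₀‖ ≤ ‖u t x‖ + ‖u t x₀ - u t x‖ := by
      have := norm_add_le (u t x) (u t x₀ - u t x)
      rwa [add_sub_cancel] at this
    linarith
  -- Sobolev at time `t` against the quarter law
  have hv2 : ContDiff ℝ 2 (u t) := (hsol.contDiff_velocity htI).of_le (by norm_cast)
  have hlow := lintegral_pow_six_ge_ball (hsol.contDiff_velocity htI).continuous ha.le hρpos x₀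
    hball
  have hup := lintegral_pow_six_le_curl hv2 (hsol.divFree t htI)
    (hLH.memLp t ⟨ht0, htI.2.le⟩)
  have hTt : 0 < T - t := sub_pos.2 htI.2
  have hTs : 0 < T - s := sub_pos.2 hs.2
  set k' : ℝ := max K 0 / Real.sqrt (T - t) with hk'
  have hk'0 : 0 ≤ k' := by positivity
  have hZ : ∫⁻ x, ‖curl (u t) x‖ₑ ^ 2 ≤ ENNReal.ofReal k' :=
    (hquarter t htI).trans (ENNReal.ofReal_le_ofReal
      (div_le_div_of_nonneg_right (le_max_left _ _) (Real.sqrt_nonneg _)))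
  have hchain : ENNReal.ofReal (a ^ 6 * ρ ^ 3 * v₁) ≤ ENNReal.ofReal (KSr ^ 6 * k' ^ 3) := by
    have hKS : (SNormLESNormFDerivOfEqConst (EuclideanSpace ℝ (Fin 3)) (volume : Measure (EuclideanSpace ℝ (Fin 3))) 2 : ℝ≥0∞) =
        ENNReal.ofReal KSr := by rw [hKSr, ENNReal.ofReal_coe_nnreal]
    calc ENNReal.ofReal (a ^ 6 * ρ ^ 3 * v₁)
        = ENNReal.ofReal (a ^ 6 * ρ ^ 3) * volume (ball (0 : (EuclideanSpace ℝ (Fin 3))) 1) := by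
          rw [ENNReal.ofReal_mul (by positivity), hv₁, ENNReal.ofReal_toReal hV₁top.ne]
      _ ≤ ∫⁻ x, ‖u t x‖ₑ ^ 6 := hlow
      _ ≤ (SNormLESNormFDerivOfEqConst (EuclideanSpace ℝ (Fin 3)) (volume : Measure (EuclideanSpace ℝ (Fin 3))) 2 : ℝ≥0∞) ^ 6 *
            (∫⁻ x, ‖curl (u t) x‖ₑ ^ 2) ^ 3 := hup
      _ ≤ ENNReal.ofReal KSr ^ 6 * ENNReal.ofReal k' ^ 3 := by rw [hKS]; gcongr
      _ = ENNReal.ofReal (KSr ^ 6 * k' ^ 3) := by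
          rw [ENNReal.ofReal_mul (by positivity), ENNReal.ofReal_pow hKSr0, ENNReal.ofReal_pow hk'0]
  have hreal : a ^ 6 * ρ ^ 3 * v₁ ≤ KSr ^ 6 * k' ^ 3 :=
    (ENNReal.ofReal_le_ofReal_iff (by positivity)).1 hchain
  -- cube roots and the monotonicity `k'(t) ≤ k'(s)`
  have hcube : (a * ν * c₁ / (4 * C₀)) ^ 3 ≤ (KSr ^ 2 * k') ^ 3 := by
    have e1 : (a * ν * c₁ / (4 * C₀)) ^ 3 = a ^ 6 * ρ ^ 3 * v₁ := by
      rw [← hc₁cube, hρ]; field_simp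
    have e2 : (KSr ^ 2 * k') ^ 3 = KSr ^ 6 * k' ^ 3 := by ring
    rw [e1, e2]; exact hreal
  have hroot : a * ν * c₁ / (4 * C₀) ≤ KSr ^ 2 * k' :=
    le_of_cube_le (by positivity) (by positivity) hcube
  have hk's : k' ≤ max K 0 / Real.sqrt (T - s) := by
    rw [hk']
    exact div_le_div_of_nonneg_left (le_max_right _ _) (Real.sqrt_pos.2 hTs)
      (Real.sqrt_le_sqrt (by linarith [ht.2]))
  have hfin : a * ν * c₁ / (4 * C₀) ≤ KSr ^ 2 * (max K 0 / Real.sqrt (T - s)) :=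
    hroot.trans (mul_le_mul_of_nonneg_left hk's (sq_nonneg _))
  have h4C₀ : 0 < 4 * C₀ := by positivity
  have hsq : 0 < Real.sqrt (T - s) := Real.sqrt_pos.2 hTs
  have hνc : 0 < ν * c₁ := mul_pos hν hc₁pos
  have h1 : a * ν * c₁ ≤ KSr ^ 2 * (max K 0 / Real.sqrt (T - s)) * (4 * C₀) :=
    (div_le_iff₀ h4C₀).1 hfin
  have h2 : a * ν * c₁ * Real.sqrt (T - s) ≤ 4 * C₀ * KSr ^ 2 * max K 0 := by
    have h3 := mul_le_mul_of_nonneg_right h1 hsq.le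
    have e : KSr ^ 2 * (max K 0 / Real.sqrt (T - s)) * (4 * C₀) * Real.sqrt (T - s) =
        4 * C₀ * KSr ^ 2 * max K 0 := by
      field_simp
    linarith [h3, e.le, e.ge]
  rw [div_div, le_div_iff₀ (mul_pos hνc hsq)]
  calc a * (ν * c₁ * Real.sqrt (T - s)) = a * ν * c₁ * Real.sqrt (T - s) := by ring
    _ ≤ 4 * C₀ * KSr ^ 2 * max K 0 := h2

end RecordTimeTypeI

end Summit.NavierStokesRegularity.NavierStokesRegularity.Theorems

end
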